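import Literature.NumberTheory.GaloisCohomology.Howard2004.DVRSettingFrobeniusCharacterProofs
import HarnessLib

/-!
# Howard 2004, H.4 across the levels — a COMPATIBLE PAIR of Frobenius characters `λ₀ : R_0 → ℤ/p^{k′}`,
# `λ₁ : R_{t+1} → ℤ/p^{k′}` with `λ₁(π^d r) = λ₀(r̄)`, `d = e_{t+1} - e_0` — proofs file (brick «C451-CL READ-COMPAT (a)»)

Topic `NumberTheory/GaloisCohomology/Howard2004`. THEOREMS ONLY: no definition, no named fact, no instance, no notation,
no `sorry`.  Cell `pub/bsd-print-x9` (seat x10b-p1-w8 g12, `--supports stmt-BirchSwinnertonDyer-22642`; print leaf G87 ↦ the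
«Flach leaf» C45.1′ / C45.1″).  Companion of `TowerDualityReadingCompatProofs`, whose hypothesis `hcompat` this file DISCHARGES.

WHY.  The H.4 readings `Θ_j : Tw(T^{(j)}) ⥲ Hom(T^{(j)}, μ_{p^{k′}})`, `Θ_j t s = exp λ_j e_j(s, t)`, of two levels `0` and `t+1`
are compatible along `ι : T^{(0)} ↪ T^{(t+1)}` / `red : T^{(t+1)} ↠ T^{(0)}` (`ι^D ∘ Θ_{t+1} = Θ₀ ∘ red`, needed to move every
term of the skew identity of Thm. 1.4.2 (ii) to the bottom level) exactly when the characters satisfy `λ₁(π^d r) = λ₀(r̄)`;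
and both must be FROBENIUS characters (`r ↦ λ_j(r ·)` bijective `R_j ⥲ Hom(R_j, ℤ/p^{k′})`) for the `Θ_j` to be bijective.

SOURCE. B. Howard, *The Heegner point Kolyvagin system*, Compositio Math. **140** (2004) = arXiv:1202.6340, §2.1 (p. 13 L20–24:
«`Hom_{S_𝔭}(N, 𝒟_𝔭(1)) ≅ Hom_{ℤ_p}(N, μ_{p^∞})`», i.e. the level rings are Frobenius / Gorenstein) and §1.6 (p. 11 L13–38:
`R_k = R/𝔪^{e_k}`, `ι ∘ red = π^d`); J. Wood, *Duality for modules over finite rings…*, Amer. J. Math. **121** (1999), Thm. 3.10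
(finite chain rings are Frobenius; tree `exists_addMonoidHom_zmod_bijective_mul_compr₂`).

WHAT IS PROVED (a `DVRSetting` `S` with H.0–H.5, levels `0`, `t+1`, `d := e_{t+1} - e_0`, `p^{k′} ∈ 𝔪^{e_{t+1}}`).
* §1 DVR letters: `pow_dvd_of_pow_mul_dvd` (cancel `π^a`), `mem_ker_algebraMap_iff_dvd` (`[r]_j = 0 ⟺ π^{e_j} ∣ r`),
  `algebraMap_pow_mul_eq_zero_of_mem_ker` (`[π^d r]_{t+1} = 0` for `r ∈ 𝔪^{e_0}`).
* §2 **`exists_compatible_frobeniusCharacters`** — there are `λ₀ : R_0 →+ ℤ/p^{k′}` and `λ₁ : R_{t+1} →+ ℤ/p^{k′}`, BOTH Frobenius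
  (`Bijective ((AddMonoidHom.mul).compr₂ λ_j)`), with `λ₁([π^d r]) = λ₀([r])` for all `r ∈ R`.  Construction: `λ₁` is the tree's
  Frobenius character of `R_{t+1}` (`exists_frobeniusCharacter_levelRing`); `λ₀ := (r̄ ↦ λ₁[π^d r])`, well defined because
  `π^d 𝔪^{e_0} = 𝔪^{e_{t+1}}` (`AddMonoidHom.liftOfRightInverse` along `R ↠ R_0`); `λ₀` is Frobenius: injectivity of `r̄ ↦ λ₀(r̄ ·)`
  from that of `λ₁` and the cancellation `π^d r ∈ (π^{d+e_0}) ⟹ r ∈ (π^{e_0})`, surjectivity by lifting a character `χ` of `R_0` to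
  `R_{t+1}`, writing it `λ₁(u ·)` and showing `u ∈ π^d R_{t+1}` (`u π^{e_0}` kills `λ₁(· v)` for all `v`).
* §3 `exists_compatible_frobeniusCharacters_semilinear` — the same with the `ℤ_p`-semilinearity binders `hlam₀`, `hlam₁` of the
  reading files (automatic: `apply_algebraMap_mul_eq_toZModPow_mul`).

HONEST FRAMING: no pairing is constructed; Prop. 1.4.1, C45.1′/C45.1″ and `thm161_dvrKolyvaginBound` are NOT proved; no summit
statement is proved; the Birch–Swinnerton-Dyer conjecture is not proved by any of this.
-/

set_option autoImplicit false

noncomputable section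

namespace Literature.NumberTheory.GaloisCohomology.Howard2004

open Function NumberField IsDedekindDomain Field
open scoped NumberField ContRepresentation
open Literature.NumberTheory.GaloisRepresentations
open Literature.RingTheory.CompleteLocalRings

namespace DVRSetting

variable {p : ℕ} [Fact p.Prime] {K : Type} [Field K] [NumberField K]
  {R : Type} [CommRing R] [IsDomain R] [IsDiscreteValuationRing R] [Algebra ℤ_[p] R]
  {N : ℕ → Type} [∀ k, AddCommGroup (N k)] [∀ k, TopologicalSpace (N k)]
  [∀ k, DiscreteTopology (N k)] [∀ k, Module R (N k)]
  {Rk : ℕ → Type} [∀ k, CommRing (Rk k)] [∀ k, IsLocalRing (Rk k)] [∀ k, TopologicalSpace (Rk k)]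
  [∀ k, DiscreteTopology (Rk k)] [∀ k, Algebra ℤ_[p] (Rk k)] [∀ k, Algebra R (Rk k)]
  [∀ k, Module (Rk k) (N k)] [∀ k, IsScalarTower R (Rk k) (N k)]
  {Nbar : Type} [AddCommGroup Nbar] [TopologicalSpace Nbar] [DiscreteTopology Nbar]
  [∀ k, Module (Rk k) Nbar]
  {Nq : ℕ → Finset (HeightOneSpectrum (𝓞 K)) → Type} [∀ k n, AddCommGroup (Nq k n)]
  [∀ k n, TopologicalSpace (Nq k n)] [∀ k n, DiscreteTopology (Nq k n)]
  [∀ k n, Module (Rk k) (Nq k n)] [∀ k n, Module R (Nq k n)]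
  [∀ k n, IsScalarTower R (Rk k) (Nq k n)]

/-! ## §1 DVR letters: cancellation of `π^a`, the kernels `𝔪^{e_j} = (π^{e_j})` -/

/-- Cancellation in the DVR: `π^a · r ∈ (π^{a+b}) ⟹ π^b ∣ r` (`π ≠ 0`, `R` a domain).
[cite: Howard2004HeegnerKolyvagin, §1.6 (arXiv:1202.6340 p. 11 L13–20)] -/
theorem pow_dvd_of_pow_mul_dvd (S : DVRSetting p K R N Rk Nbar Nq) (hy : S.SatisfiesH) {a b : ℕ} {r : R}
    (h : S.π ^ (a + b) ∣ S.π ^ a * r) : S.π ^ b ∣ r := by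
  have hπ : S.π ≠ 0 := fun h0 =>
    IsDiscreteValuationRing.not_a_field R (by rw [hy.unif, h0, Ideal.span_singleton_eq_bot])
  rw [pow_add] at h
  exact (mul_dvd_mul_iff_left (pow_ne_zero a hπ)).1 h

/-- `[r]_j = 0` in `R_j = R/𝔪^{e_j}` iff `π^{e_j} ∣ r`. [cite: Howard2004HeegnerKolyvagin, §1.6 (arXiv:1202.6340 p. 11 L13–20, L33–34)] -/
theorem algebraMap_eq_zero_iff_dvd (S : DVRSetting p K R N Rk Nbar Nq) (hy : S.SatisfiesH) (j : ℕ) (r : R) :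
    algebraMap R (Rk j) r = 0 ↔ S.π ^ S.e j ∣ r := by
  rw [← RingHom.mem_ker, hy.ker_algebraMap, hy.unif, Ideal.span_singleton_pow, Ideal.mem_span_singleton]

/-- `e_0 + d = e_{t+1}` for `d = e_{t+1} - e_0`. [cite: Howard2004HeegnerKolyvagin, §1.6 (arXiv:1202.6340 p. 11 L13–16)] -/
theorem e_zero_add_sub (S : DVRSetting p K R N Rk Nbar Nq) (hy : S.SatisfiesH) (t : ℕ) :
    S.e 0 + (S.e (t + 1) - S.e 0) = S.e (t + 1) :=
  Nat.add_sub_cancel' (hy.e_strictMono.monotone (Nat.zero_le (t + 1)))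

/-- `[π^d r]_{t+1} = 0` whenever `[r]_0 = 0` (`π^d 𝔪^{e_0} ⊆ 𝔪^{e_{t+1}}`).
[cite: Howard2004HeegnerKolyvagin, §1.6 (arXiv:1202.6340 p. 11 L13–20)] -/
theorem algebraMap_pow_mul_eq_zero (S : DVRSetting p K R N Rk Nbar Nq) (hy : S.SatisfiesH) (t : ℕ) {r : R}
    (hr : algebraMap R (Rk 0) r = 0) : algebraMap R (Rk (t + 1)) (S.π ^ (S.e (t + 1) - S.e 0) * r) = 0 := by
  rw [S.algebraMap_eq_zero_iff_dvd hy] at hr ⊢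
  obtain ⟨c, rfl⟩ := hr
  exact ⟨c, by rw [← mul_assoc, ← pow_add, Nat.sub_add_cancel (hy.e_strictMono.monotone (Nat.zero_le (t + 1)))]⟩

/-! ## §2 The compatible pair of Frobenius characters -/

/-- **A compatible pair of Frobenius characters on `R_0` and `R_{t+1}`.**  For `p^{k′} ∈ 𝔪^{e_{t+1}}` there are additive
`λ₀ : R_0 → ℤ/p^{k′}` and `λ₁ : R_{t+1} → ℤ/p^{k′}`, both FROBENIUS characters (`r ↦ λ_j(r ·)` bijective), with
`λ₁([π^d r]_{t+1}) = λ₀([r]_0)` for every `r ∈ R` (`d = e_{t+1} - e_0`) — the hypothesis `hcompat` of `TowerDualityReadingCompatProofs`.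
[cite: Howard2004HeegnerKolyvagin, §2.1 (arXiv:1202.6340 p. 13 L20–24) and §1.6 (p. 11 L13–38)] [cite: Wood1999DualityCodesFiniteRings, Thm. 3.10] -/
theorem exists_compatible_frobeniusCharacters (S : DVRSetting p K R N Rk Nbar Nq) (hy : S.SatisfiesH) (t : ℕ) {k' : ℕ}
    (hk' : ((p : ℕ) : R) ^ k' ∈ IsLocalRing.maximalIdeal R ^ S.e (t + 1)) :
    ∃ (lam₀ : Rk 0 →+ ZMod (p ^ k')) (lam₁ : Rk (t + 1) →+ ZMod (p ^ k')),
      Bijective ((AddMonoidHom.mul : Rk 0 →+ Rk 0 →+ Rk 0).compr₂ lam₀) ∧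
      Bijective ((AddMonoidHom.mul : Rk (t + 1) →+ Rk (t + 1) →+ Rk (t + 1)).compr₂ lam₁) ∧
      ∀ r : R, lam₁ (algebraMap R (Rk (t + 1)) (S.π ^ (S.e (t + 1) - S.e 0) * r)) = lam₀ (algebraMap R (Rk 0) r) := by
  obtain ⟨lam₁, hfrob₁⟩ := S.exists_frobeniusCharacter_levelRing hy (t + 1) hk'
  -- abbreviations
  set d : ℕ := S.e (t + 1) - S.e 0 with hd
  set f₀ : R →+ Rk 0 := (algebraMap R (Rk 0)).toAddMonoidHom with hf₀
  set f₁ : R →+ Rk (t + 1) := (algebraMap R (Rk (t + 1))).toAddMonoidHom with hf₁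
  have hs₀ : Surjective f₀ := hy.algebraMap_surjective 0
  have hs₁ : Surjective f₁ := hy.algebraMap_surjective (t + 1)
  -- unpacking the Frobenius property of `λ₁`: `(∀ v, λ₁ (u v) = 0) → u = 0`
  have hinj₁ : ∀ u : Rk (t + 1), (∀ s : R, lam₁ (u * algebraMap R (Rk (t + 1)) s) = 0) → u = 0 := by
    intro u hu
    refine hfrob₁.1 (a₂ := 0) ?_
    refine AddMonoidHom.ext fun v => ?_
    obtain ⟨s, rfl⟩ := hs₁ v
    rw [AddMonoidHom.compr₂_apply, AddMonoidHom.compr₂_apply, map_zero, AddMonoidHom.zero_apply, map_zero]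
    exact hu s
  -- `φ := λ₁ ∘ [π^d ·]_{t+1}` kills `ker (R → R_0)`
  let φ : R →+ ZMod (p ^ k') := lam₁.comp (f₁.comp (AddMonoidHom.mulLeft (S.π ^ d)))
  have hφ : ∀ r, φ r = lam₁ (algebraMap R (Rk (t + 1)) (S.π ^ d * r)) := fun _ => rfl
  have hφker : f₀.ker ≤ φ.ker := by
    intro r hr
    rw [AddMonoidHom.mem_ker] at hr ⊢
    rw [hφ, S.algebraMap_pow_mul_eq_zero hy t hr, map_zero]
  -- `λ₀` := the descent of `φ` to `R_0`
  let lam₀ : Rk 0 →+ ZMod (p ^ k') :=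
    f₀.liftOfRightInverse (surjInv hs₀) (rightInverse_surjInv hs₀) ⟨φ, hφker⟩
  have hlam₀ : ∀ r : R, lam₀ (algebraMap R (Rk 0) r) = lam₁ (algebraMap R (Rk (t + 1)) (S.π ^ d * r)) := fun r =>
    (f₀.liftOfRightInverse_comp_apply (surjInv hs₀) (rightInverse_surjInv hs₀) ⟨φ, hφker⟩ r).trans (hφ r)
  refine ⟨lam₀, lam₁, ⟨?_, ?_⟩, hfrob₁, fun r => (hlam₀ r).symm⟩
  · -- injectivity of `x ↦ λ₀(x ·)`
    intro x x' hxx'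
    rw [← sub_eq_zero]
    obtain ⟨r, hr⟩ := hs₀ (x - x')
    have h0 : ∀ s : R, lam₀ ((x - x') * algebraMap R (Rk 0) s) = 0 := fun s => by
      have := DFunLike.congr_fun hxx' (algebraMap R (Rk 0) s)
      rw [AddMonoidHom.compr₂_apply, AddMonoidHom.compr₂_apply, AddMonoidHom.mul_apply, AddMonoidHom.mul_apply] at this
      rw [sub_mul, map_sub, sub_eq_zero, this]
    -- `[π^d r]_{t+1} = 0`
    have hπr : algebraMap R (Rk (t + 1)) (S.π ^ d * r) = 0 := by
      refine hinj₁ _ fun s => ?_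
      rw [← map_mul (algebraMap R (Rk (t + 1))), mul_assoc, ← hlam₀, map_mul (algebraMap R (Rk 0))]
      change lam₀ (f₀ r * _) = 0
      rw [hr]
      exact h0 s
    -- cancel `π^d`
    rw [S.algebraMap_eq_zero_iff_dvd hy, ← S.e_zero_add_sub hy t, add_comm] at hπr
    have hr0 : algebraMap R (Rk 0) r = 0 := (S.algebraMap_eq_zero_iff_dvd hy 0 r).2 (S.pow_dvd_of_pow_mul_dvd hy hπr)
    rw [← hr]
    exact hr0
  · -- surjectivity of `x ↦ λ₀(x ·)`
    intro χ
    -- lift `χ ∘ [·]_0` to `R_{t+1}`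
    let ψ : R →+ ZMod (p ^ k') := χ.comp f₀
    have hψker : f₁.ker ≤ ψ.ker := by
      intro r hr
      rw [AddMonoidHom.mem_ker] at hr ⊢
      change algebraMap R (Rk (t + 1)) r = 0 at hr
      change χ (algebraMap R (Rk 0) r) = 0
      have hr' : algebraMap R (Rk 0) r = 0 := by
        rw [S.algebraMap_eq_zero_iff_dvd hy] at hr ⊢
        exact (pow_dvd_pow _ (hy.e_strictMono.monotone (Nat.zero_le (t + 1)))).trans hr
      rw [hr', map_zero]
    let χ₁ : Rk (t + 1) →+ ZMod (p ^ k') := f₁.liftOfRightInverse (surjInv hs₁) (rightInverse_surjInv hs₁) ⟨ψ, hψker⟩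
    have hχ₁ : ∀ s : R, χ₁ (algebraMap R (Rk (t + 1)) s) = χ (algebraMap R (Rk 0) s) := fun s =>
      f₁.liftOfRightInverse_comp_apply (surjInv hs₁) (rightInverse_surjInv hs₁) ⟨ψ, hψker⟩ s
    obtain ⟨u, hu⟩ := hfrob₁.2 χ₁
    have hu' : ∀ s : R, lam₁ (u * algebraMap R (Rk (t + 1)) s) = χ (algebraMap R (Rk 0) s) := fun s => by
      rw [← hχ₁ s, ← hu, AddMonoidHom.compr₂_apply, AddMonoidHom.mul_apply]
    obtain ⟨w, rfl⟩ := hs₁ u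
    -- `[w π^{e_0}]_{t+1} = 0`, hence `π^d ∣ w`
    have hw0 : algebraMap R (Rk (t + 1)) (S.π ^ S.e 0 * w) = 0 := by
      refine hinj₁ _ fun s => ?_
      rw [← map_mul (algebraMap R (Rk (t + 1))), show S.π ^ S.e 0 * w * s = w * (S.π ^ S.e 0 * s) by ring,
        map_mul (algebraMap R (Rk (t + 1)))]
      change lam₁ (f₁ w * _) = 0
      rw [hu' (S.π ^ S.e 0 * s), (S.algebraMap_eq_zero_iff_dvd hy 0 _).2 (dvd_mul_right _ _), map_zero]
    rw [S.algebraMap_eq_zero_iff_dvd hy, ← S.e_zero_add_sub hy t] at hw0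
    obtain ⟨w', rfl⟩ := S.pow_dvd_of_pow_mul_dvd hy hw0
    refine ⟨algebraMap R (Rk 0) w', AddMonoidHom.ext fun x => ?_⟩
    obtain ⟨s, rfl⟩ := hs₀ x
    change lam₀ (algebraMap R (Rk 0) w' * algebraMap R (Rk 0) s) = χ (algebraMap R (Rk 0) s)
    rw [← map_mul, hlam₀, ← mul_assoc, ← hu' s, map_mul]
    rfl

/-! ## §3 With the `ℤ_p`-semilinearity binders of the reading files -/

/-- **The compatible pair, with the `ℤ_p`-semilinearity `hlam` of the reading files** (automatic on rings killed by `p^{k′}`):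
the binders `lam₀ hlam₀ lam₁ hlam₁ hcompat` of `TowerDualityReadingCompatProofs`, both characters Frobenius.
[cite: Howard2004HeegnerKolyvagin, §2.1 (arXiv:1202.6340 p. 13 L20–24) and §1.6 (p. 11 L13–38)] [cite: Wood1999DualityCodesFiniteRings, Thm. 3.10] -/
theorem exists_compatible_frobeniusCharacters_semilinear (S : DVRSetting p K R N Rk Nbar Nq) (hy : S.SatisfiesH) (t : ℕ)
    {k' : ℕ} (hk' : ((p : ℕ) : R) ^ k' ∈ IsLocalRing.maximalIdeal R ^ S.e (t + 1)) :
    ∃ (lam₀ : Rk 0 →+ ZMod (p ^ k')) (lam₁ : Rk (t + 1) →+ ZMod (p ^ k'))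
      (_ : ∀ (z : ℤ_[p]) (r : Rk 0), lam₀ (algebraMap ℤ_[p] (Rk 0) z * r) = PadicInt.toZModPow k' z * lam₀ r)
      (_ : ∀ (z : ℤ_[p]) (r : Rk (t + 1)), lam₁ (algebraMap ℤ_[p] (Rk (t + 1)) z * r) = PadicInt.toZModPow k' z * lam₁ r),
      Bijective ((AddMonoidHom.mul : Rk 0 →+ Rk 0 →+ Rk 0).compr₂ lam₀) ∧
      Bijective ((AddMonoidHom.mul : Rk (t + 1) →+ Rk (t + 1) →+ Rk (t + 1)).compr₂ lam₁) ∧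
      ∀ r : R, lam₁ (algebraMap R (Rk (t + 1)) (S.π ^ (S.e (t + 1) - S.e 0) * r)) = lam₀ (algebraMap R (Rk 0) r) := by
  obtain ⟨lam₀, lam₁, h₀, h₁, hc⟩ := S.exists_compatible_frobeniusCharacters hy t hk'
  have hk0 : ((p : ℕ) : R) ^ k' ∈ IsLocalRing.maximalIdeal R ^ S.e 0 :=
    Ideal.pow_le_pow_right (hy.e_strictMono.monotone (Nat.zero_le (t + 1))) hk'
  exact ⟨lam₀, lam₁, apply_algebraMap_mul_eq_toZModPow_mul (S.natCast_pow_smul_levelRing_eq_zero hy 0 hk0) lam₀,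
    apply_algebraMap_mul_eq_toZModPow_mul (S.natCast_pow_smul_levelRing_eq_zero hy (t + 1) hk') lam₁, h₀, h₁, hc⟩

end DVRSetting

end Literature.NumberTheory.GaloisCohomology.Howard2004

end
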